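import Literature.Barriers.CriticalPhenomena.WeaklySAWFluctuationIntegral
import Mathlib.MeasureTheory.Group.Prod
import HarnessLib

/-!
# BBS 2015, §5.1: Gaussian convolutions compose — `μ_{C₂} * (μ_{C₁} * f) = μ_{C₁+C₂} * f`
# (the bosonic, degree-zero case of Proposition 5.1, `E_{C'+C}θ = E_{C'}θ ∘ E_Cθ`)

Bauerschmidt–Brydges–Slade, CMP 337 (2015), arXiv:1403.7422, §5.1: "It is an elementary fact that if
`X₁ ∼ N(0,σ₁²)` and `X₂ ∼ N(0,σ₂²)` are independent … then `X₁+X₂ ∼ N(0,σ₁²+σ₂²)` … `E(f(X)) =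
E(E(f(X₁+X₂) | X₂))` (5.1). The elementary identity extends to the super-expectation: Proposition 5.1,
`E_{C'+C₁}θF = (E_{C'}θ ∘ E_{C₁}θ)F`." This file proves the bosonic identity behind (5.1) for the complex
Gaussian measures `μ_C` on `ℂ^Λ` of `WeaklySAWComplexGaussian.lean` and the convolution `μ_C * f`
(`gaussConvolution`, `C = A⁻¹`) of `WeaklySAWFluctuationIntegral.lean`, for REAL symmetric positive-definite
`A₁ = C₁⁻¹`, `A₂ = C₂⁻¹` (the case of the covariance decompositions used in the sequel):

* `convMatrix A₁ A₂ = A₁(A₁+A₂)⁻¹A₂` with `inv_convMatrix`: `(convMatrix A₁ A₂)⁻¹ = A₁⁻¹ + A₂⁻¹` (the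
  covariances add);
* the completed square `quadForm_sub_add_quadForm`:
  `(ξ-ξ₂)A₁(ξ̄-ξ̄₂) + ξ₂A₂ξ̄₂ = (ξ₂-u)(A₁+A₂)(ξ̄₂-ū) + ξAξ̄`, `u = (A₁+A₂)⁻¹A₁ξ`, `A = convMatrix A₁ A₂`;
* `integral_gaussWeight_sub_mul_gaussWeight`: `∫ e^{-(ξ-ξ₂)A₁(ξ̄-ξ̄₂)} e^{-ξ₂A₂ξ̄₂} dξ₂ = Z_{A₁+A₂} e^{-ξAξ̄}`;
* **`gaussConvolution_gaussConvolution`**: `μ_{C₂} * (μ_{C₁} * f) = μ_{C₁+C₂} * f` for every continuous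
  `f` of polynomial growth — Fubini, the shear `(ξ₂,ξ₁) ↦ (ξ₂, ξ₂+ξ₁)` (measure preserving), translation
  invariance, and `Z_B = π^{|Λ|}/det B`;
* **`convTheta_ofFun_gaussConvolution`**: `E_{C₂}θ(E_{C₁}θ f) = E_{C₁+C₂}θ f` for `0`-forms `f` (with
  `convTheta_ofFun`, eq. (4.22)) — Proposition 5.1 on degree-zero forms.

Everything is proved; no named facts. `-- TODO(general form):` complex `A₁, A₂` with positive-definite
Hermitian part (the generality of Proposition 5.1) and forms of positive degree are not treated here.
-/

noncomputable section

open MeasureTheory Complex ComplexConjugate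
open Literature.MathematicalPhysics.QuantumLattice
open scoped BigOperators

namespace Literature.Barriers.CriticalPhenomena

namespace CTWSAW

section Convolution

variable {Λ : Type*} [LinearOrder Λ] [Fintype Λ]

/-! #### Linear algebra of real symmetric matrices and the completed square -/

/-- The pairing `(a, b̄) = Σ_x a_x b̄_x`. [folklore] -/
def pair (a b : Λ → ℂ) : ℂ := ∑ x, a x * conj (b x)

omit [LinearOrder Λ] in
/-- `φMφ̄ = (φ, (Mφ)‾)` for a matrix with real entries. [folklore] -/
theorem quadForm_eq_pair_mulVec {M : Matrix Λ Λ ℂ} (hM : ∀ x y, conj (M x y) = M x y) (a : Λ → ℂ) :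
    Boson.quadForm M a = pair a (M.mulVec a) := by
  unfold Boson.quadForm pair Matrix.mulVec dotProduct
  refine Finset.sum_congr rfl fun x _ => ?_
  rw [map_sum, Finset.mul_sum]
  refine Finset.sum_congr rfl fun y _ => ?_
  rw [map_mul, hM, mul_assoc]

omit [LinearOrder Λ] in
/-- `(Ma, b̄) = (a, (Mb)‾)` for a real symmetric matrix. [folklore] -/
theorem pair_mulVec_comm {M : Matrix Λ Λ ℂ} (hMt : M.transpose = M) (hM : ∀ x y, conj (M x y) = M x y)
    (a b : Λ → ℂ) : pair (M.mulVec a) b = pair a (M.mulVec b) := by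
  have hsymm : ∀ x y, M y x = M x y := fun x y => by
    have e := congrFun (congrFun hMt x) y
    rwa [Matrix.transpose_apply] at e
  unfold pair Matrix.mulVec dotProduct
  simp_rw [Finset.sum_mul, map_sum, Finset.mul_sum, map_mul, hM]
  rw [Finset.sum_comm]
  refine Finset.sum_congr rfl fun x _ => Finset.sum_congr rfl fun y _ => ?_
  rw [hsymm x y]
  ring

omit [LinearOrder Λ] in
/-- `(a + a', b̄) = (a,b̄) + (a',b̄)`. [folklore] -/
theorem pair_add_left (a a' b : Λ → ℂ) : pair (a + a') b = pair a b + pair a' b := by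
  simp only [pair, Pi.add_apply, add_mul, Finset.sum_add_distrib]

omit [LinearOrder Λ] in
/-- `(a, (b+b')‾) = (a,b̄) + (a,b̄')`. [folklore] -/
theorem pair_add_right (a b b' : Λ → ℂ) : pair a (b + b') = pair a b + pair a b' := by
  simp only [pair, Pi.add_apply, map_add, mul_add, Finset.sum_add_distrib]

omit [LinearOrder Λ] in
/-- `(-a, b̄) = -(a,b̄)`. [folklore] -/
theorem pair_neg_left (a b : Λ → ℂ) : pair (-a) b = -pair a b := by
  simp only [pair, Pi.neg_apply, neg_mul, Finset.sum_neg_distrib]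

omit [LinearOrder Λ] in
/-- `(a, (-b)‾) = -(a,b̄)`. [folklore] -/
theorem pair_neg_right (a b : Λ → ℂ) : pair a (-b) = -pair a b := by
  simp only [pair, Pi.neg_apply, map_neg, mul_neg, Finset.sum_neg_distrib]

omit [LinearOrder Λ] in
/-- For a real symmetric `M` and `Mh = J`: `(h+φ)M(h̄+φ̄) = φMφ̄ + (φ,J̄) + (J,φ̄) + (h,J̄)`. [folklore] -/
theorem quadForm_add_eq' {M : Matrix Λ Λ ℂ} (hMt : M.transpose = M) (hM : ∀ x y, conj (M x y) = M x y)
    {h J : Λ → ℂ} (hMh : M.mulVec h = J) (φ : Λ → ℂ) :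
    Boson.quadForm M (h + φ) = Boson.quadForm M φ + pair φ J + pair J φ + pair h J := by
  rw [quadForm_eq_pair_mulVec hM, quadForm_eq_pair_mulVec hM, Matrix.mulVec_add, hMh, pair_add_left,
    pair_add_right, pair_add_right, ← pair_mulVec_comm hMt hM h φ, hMh]
  ring

omit [LinearOrder Λ] in
/-- `φ(M + tN)φ̄ = φMφ̄ + t·φNφ̄` and hence `φ(M - N)φ̄ = φMφ̄ - φNφ̄`. [folklore] -/
theorem quadForm_sub (M N : Matrix Λ Λ ℂ) (φ : Λ → ℂ) :
    Boson.quadForm (M - N) φ = Boson.quadForm M φ - Boson.quadForm N φ := by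
  have h := quadForm_add_smul M N (-1) φ
  rw [neg_one_smul, ← sub_eq_add_neg] at h
  rw [h]; ring

omit [LinearOrder Λ] in
/-- Products of real matrices are real. [folklore] -/
theorem conj_mul_apply {M N : Matrix Λ Λ ℂ} (hM : ∀ x y, conj (M x y) = M x y) (hN : ∀ x y, conj (N x y) = N x y)
    (x y : Λ) : conj ((M * N) x y) = (M * N) x y := by
  rw [Matrix.mul_apply, map_sum]
  exact Finset.sum_congr rfl fun z _ => by rw [map_mul, hM, hN]

/-- The inverse of a real matrix is real. [folklore] -/
theorem conj_inv_apply {M : Matrix Λ Λ ℂ} (hM : ∀ x y, conj (M x y) = M x y) (hMu : IsUnit M.det) (x y : Λ) :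
    conj (M⁻¹ x y) = M⁻¹ x y := by
  have hA : M.map (starRingEnd ℂ) = M := by ext i j; exact hM i j
  have hleft : M⁻¹.map (starRingEnd ℂ) * M = 1 := by
    calc M⁻¹.map (starRingEnd ℂ) * M = M⁻¹.map (starRingEnd ℂ) * M.map (starRingEnd ℂ) := by rw [hA]
      _ = (M⁻¹ * M).map (starRingEnd ℂ) := Matrix.map_mul.symm
      _ = 1 := by rw [Matrix.nonsing_inv_mul _ hMu, Matrix.map_one _ (map_zero _) (map_one _)]
  have h : M⁻¹ = M⁻¹.map (starRingEnd ℂ) := Matrix.inv_eq_left_inv hleft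
  exact (congrFun (congrFun h x) y).symm

variable {A₁ A₂ : Matrix Λ Λ ℂ}

/-- **`A = A₁(A₁+A₂)⁻¹A₂`**, the matrix with `A⁻¹ = A₁⁻¹ + A₂⁻¹`. [cite: BauerschmidtBrydgesSlade2015LogCorr, §5.1 (X₁+X₂ ∼ N(0, σ₁²+σ₂²))] -/
def convMatrix (A₁ A₂ : Matrix Λ Λ ℂ) : Matrix Λ Λ ℂ := A₁ * (A₁ + A₂)⁻¹ * A₂

/-- `A₁(A₁+A₂)⁻¹A₂ = A₁ - A₁(A₁+A₂)⁻¹A₁` (`A₁+A₂` invertible). [folklore] -/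
theorem convMatrix_eq_sub (hB : IsUnit (A₁ + A₂).det) :
    convMatrix A₁ A₂ = A₁ - A₁ * (A₁ + A₂)⁻¹ * A₁ := by
  refine eq_sub_of_add_eq ?_
  rw [convMatrix, ← Matrix.mul_add, add_comm A₂ A₁, Matrix.mul_assoc, Matrix.nonsing_inv_mul _ hB, Matrix.mul_one]

/-- **The covariances add: `(A₁(A₁+A₂)⁻¹A₂)⁻¹ = A₁⁻¹ + A₂⁻¹`** (`A₁, A₂, A₁+A₂` invertible).
[cite: BauerschmidtBrydgesSlade2015LogCorr, §5.1, Proposition 5.1 (E_{C'+C₁})] -/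
theorem inv_convMatrix (h₁ : IsUnit A₁.det) (h₂ : IsUnit A₂.det) (hB : IsUnit (A₁ + A₂).det) :
    (convMatrix A₁ A₂)⁻¹ = A₁⁻¹ + A₂⁻¹ := by
  refine Matrix.inv_eq_right_inv ?_
  calc convMatrix A₁ A₂ * (A₁⁻¹ + A₂⁻¹)
      = A₁ * (A₁ + A₂)⁻¹ * (A₂ * A₁⁻¹ + A₂ * A₂⁻¹) := by rw [convMatrix, Matrix.mul_assoc, Matrix.mul_add]
    _ = A₁ * (A₁ + A₂)⁻¹ * ((A₂ + A₁) * A₁⁻¹) := by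
        rw [Matrix.mul_nonsing_inv _ h₂, Matrix.add_mul, Matrix.mul_nonsing_inv _ h₁]
    _ = A₁ * ((A₁ + A₂)⁻¹ * (A₁ + A₂)) * A₁⁻¹ := by rw [add_comm A₂ A₁, Matrix.mul_assoc, Matrix.mul_assoc, Matrix.mul_assoc]
    _ = 1 := by rw [Matrix.nonsing_inv_mul _ hB, Matrix.mul_one, Matrix.mul_nonsing_inv _ h₁]

/-- The hypotheses on a kinetic matrix used in this file: real entries, symmetric, and positive-definite real
part `Re φAφ̄ ≥ cΣ|φ_x|²` with `c > 0`. [folklore] -/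
structure RealPosDef (A : Matrix Λ Λ ℂ) (c : ℝ) : Prop where
  symm : A.transpose = A
  real : ∀ x y, conj (A x y) = A x y
  pos : 0 < c
  bound : ∀ φ : Λ → ℂ, c * ∑ x, ‖φ x‖ ^ 2 ≤ (Boson.quadForm A φ).re

variable {c₁ c₂ : ℝ}

omit [LinearOrder Λ] in
/-- `A₁ + A₂` is real symmetric positive-definite (`≥ c₁ + c₂`). [folklore] -/
theorem RealPosDef.add (h₁ : RealPosDef A₁ c₁) (h₂ : RealPosDef A₂ c₂) : RealPosDef (A₁ + A₂) (c₁ + c₂) where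
  symm := by rw [Matrix.transpose_add, h₁.symm, h₂.symm]
  real x y := by rw [Matrix.add_apply, map_add, h₁.real, h₂.real]
  pos := add_pos h₁.pos h₂.pos
  bound φ := by
    have e := quadForm_add_smul A₁ A₂ 1 φ
    rw [one_smul, one_mul] at e
    rw [e, Complex.add_re]
    linarith [h₁.bound φ, h₂.bound φ]

/-- A real symmetric positive-definite matrix is invertible. [folklore] -/
theorem RealPosDef.isUnit_det {A : Matrix Λ Λ ℂ} {c : ℝ} (h : RealPosDef A c) : IsUnit A.det :=
  (Matrix.isUnit_iff_isUnit_det A).1 (Boson.isUnit_of_re_quadForm_ge h.pos h.bound)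

/-- **The completed square**: `(ξ-ξ₂)A₁(ξ̄-ξ̄₂) + ξ₂A₂ξ̄₂ = (ξ₂-u)(A₁+A₂)(ξ̄₂-ū) + ξAξ̄` with `u = (A₁+A₂)⁻¹A₁ξ`,
`A = A₁(A₁+A₂)⁻¹A₂`. [cite: BauerschmidtBrydgesSlade2015LogCorr, §5.1 (proof of (5.1): the Gaussian convolution)] -/
theorem quadForm_sub_add_quadForm (h₁ : RealPosDef A₁ c₁) (h₂ : RealPosDef A₂ c₂) (ξ ξ₂ : Λ → ℂ) :
    Boson.quadForm A₁ (ξ - ξ₂) + Boson.quadForm A₂ ξ₂ =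
      Boson.quadForm (A₁ + A₂) (ξ₂ - (A₁ + A₂)⁻¹.mulVec (A₁.mulVec ξ)) + Boson.quadForm (convMatrix A₁ A₂) ξ := by
  set B := A₁ + A₂ with hBdef
  have hB : RealPosDef B (c₁ + c₂) := h₁.add h₂
  have hBu : IsUnit B.det := hB.isUnit_det
  have hBir : ∀ x y, conj (B⁻¹ x y) = B⁻¹ x y := conj_inv_apply hB.real hBu
  have hBit : B⁻¹.transpose = B⁻¹ := by rw [Matrix.transpose_nonsing_inv, hB.symm]
  set u := B⁻¹.mulVec (A₁.mulVec ξ) with hu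
  -- the two squares, expanded
  have hsq1 : Boson.quadForm B (ξ₂ - u) = Boson.quadForm B ξ₂ + pair ξ₂ (-(A₁.mulVec ξ)) +
      pair (-(A₁.mulVec ξ)) ξ₂ + pair (-u) (-(A₁.mulVec ξ)) := by
    rw [sub_eq_neg_add]
    refine quadForm_add_eq' hB.symm hB.real ?_ ξ₂
    rw [Matrix.mulVec_neg, hu, Matrix.mulVec_mulVec, Matrix.mul_nonsing_inv _ hBu, Matrix.one_mulVec]
  have hsq2 : Boson.quadForm A₁ (ξ - ξ₂) = Boson.quadForm A₁ ξ + pair ξ (-(A₁.mulVec ξ₂)) +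
      pair (-(A₁.mulVec ξ₂)) ξ + pair (-ξ₂) (-(A₁.mulVec ξ₂)) := by
    rw [sub_eq_neg_add]
    refine quadForm_add_eq' h₁.symm h₁.real ?_ ξ
    rw [Matrix.mulVec_neg]
  -- the pieces
  have hB2 : Boson.quadForm B ξ₂ = Boson.quadForm A₁ ξ₂ + Boson.quadForm A₂ ξ₂ := by
    have e := quadForm_add_smul A₁ A₂ 1 ξ₂
    rwa [one_smul, one_mul] at e
  have hself : pair (-ξ₂) (-(A₁.mulVec ξ₂)) = Boson.quadForm A₁ ξ₂ := by
    rw [pair_neg_left, pair_neg_right, neg_neg, ← quadForm_eq_pair_mulVec h₁.real]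
  have hcross1 : pair ξ (-(A₁.mulVec ξ₂)) = pair (-(A₁.mulVec ξ)) ξ₂ := by
    rw [pair_neg_right, pair_neg_left, ← pair_mulVec_comm h₁.symm h₁.real ξ ξ₂]
  have hcross2 : pair (-(A₁.mulVec ξ₂)) ξ = pair ξ₂ (-(A₁.mulVec ξ)) := by
    rw [pair_neg_left, pair_neg_right, pair_mulVec_comm h₁.symm h₁.real ξ₂ ξ]
  have huu : pair (-u) (-(A₁.mulVec ξ)) = Boson.quadForm (A₁ * B⁻¹ * A₁) ξ := by
    rw [pair_neg_left, pair_neg_right, neg_neg, hu, pair_mulVec_comm hBit hBir, pair_mulVec_comm h₁.symm h₁.real,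
      Matrix.mulVec_mulVec, Matrix.mulVec_mulVec,
      ← quadForm_eq_pair_mulVec (conj_mul_apply (conj_mul_apply h₁.real hBir) h₁.real)]
  rw [hsq1, hsq2, hB2, hself, hcross1, hcross2, huu, convMatrix_eq_sub hBu, quadForm_sub]
  ring

/-! #### The Gaussian integral over the fluctuation variable -/

/-- **`∫ e^{-(ξ-ξ₂)A₁(ξ̄-ξ̄₂)} e^{-ξ₂A₂ξ̄₂} dξ₂ = Z_{A₁+A₂} · e^{-ξAξ̄}`**, `A = A₁(A₁+A₂)⁻¹A₂`. [cite: BauerschmidtBrydgesSlade2015LogCorr, §5.1 (the Gaussian convolution behind (5.1))] -/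
theorem integral_gaussWeight_sub_mul_gaussWeight (h₁ : RealPosDef A₁ c₁) (h₂ : RealPosDef A₂ c₂) (ξ : Λ → ℂ) :
    ∫ ξ₂ : Λ → ℂ, Boson.gaussWeight A₁ (ξ - ξ₂) * Boson.gaussWeight A₂ ξ₂ =
      Boson.partitionFn (A₁ + A₂) * Boson.gaussWeight (convMatrix A₁ A₂) ξ := by
  set u := (A₁ + A₂)⁻¹.mulVec (A₁.mulVec ξ) with hu
  have hpt : ∀ ξ₂, Boson.gaussWeight A₁ (ξ - ξ₂) * Boson.gaussWeight A₂ ξ₂ =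
      Boson.gaussWeight (A₁ + A₂) (-u + ξ₂) * Boson.gaussWeight (convMatrix A₁ A₂) ξ := by
    intro ξ₂
    simp only [Boson.gaussWeight]
    rw [← Complex.exp_add, ← Complex.exp_add, ← neg_add, ← neg_add, quadForm_sub_add_quadForm h₁ h₂ ξ ξ₂, hu,
      neg_add_eq_sub]
  simp_rw [hpt]
  rw [integral_mul_const, integral_add_left_eq_self (fun x => Boson.gaussWeight (A₁ + A₂) x) (-u)]
  rfl

/-! #### The composition of two Gaussian convolutions -/

omit [LinearOrder Λ] in
/-- `1 + a + b + c ≤ (1+a)(1+b)(1+c)` for nonnegative reals. [folklore] -/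
theorem one_add_three_le {a b d : ℝ} (ha : 0 ≤ a) (hb : 0 ≤ b) (hd : 0 ≤ d) :
    1 + a + b + d ≤ (1 + a) * (1 + b) * (1 + d) := by nlinarith [mul_nonneg ha hb, mul_nonneg (mul_nonneg ha hb) hd, mul_nonneg ha hd, mul_nonneg hb hd]

/-- Integrability of `f(φ+ξ₂+ξ₁) e^{-ξ₁A₁ξ̄₁} e^{-ξ₂A₂ξ̄₂}` on `ℂ^Λ × ℂ^Λ`. [folklore] -/
theorem integrable_shift_mul_gaussWeight_prod (h₁ : RealPosDef A₁ c₁) (h₂ : RealPosDef A₂ c₂) {f : FieldFun Λ}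
    (hf : Continuous f) {K : ℝ} {k : ℕ} (hfb : ∀ x, ‖f x‖ ≤ K * (1 + ‖x‖) ^ k) (φ : Λ → ℂ) :
    Integrable (fun z : (Λ → ℂ) × (Λ → ℂ) => f (φ + z.1 + z.2) * Boson.gaussWeight A₁ z.2 * Boson.gaussWeight A₂ z.1)
      ((volume : Measure (Λ → ℂ)).prod volume) := by
  have hK : 0 ≤ K := by
    have := hfb 0
    have h0 : (0 : ℝ) ≤ ‖f 0‖ := norm_nonneg _
    simp at this
    linarith
  -- the two one-variable envelopes
  have hg₁ : Integrable fun ξ : Λ → ℂ => ((((1 + ‖ξ‖) ^ k : ℝ)) : ℂ) * Boson.gaussWeight A₁ ξ :=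
    Boson.integrable_mul_gaussWeight h₁.pos h₁.bound (by fun_prop) (M := 1) (k := k) fun ξ => by
      rw [Complex.norm_real, Real.norm_eq_abs, abs_of_nonneg (by positivity), one_mul]
  have hg₂ : Integrable fun ξ : Λ → ℂ => ((((1 + ‖ξ‖) ^ k : ℝ)) : ℂ) * Boson.gaussWeight A₂ ξ :=
    Boson.integrable_mul_gaussWeight h₂.pos h₂.bound (by fun_prop) (M := 1) (k := k) fun ξ => by
      rw [Complex.norm_real, Real.norm_eq_abs, abs_of_nonneg (by positivity), one_mul]
  have hprod := ((hg₂.norm.mul_prod hg₁.norm).const_mul (K * (1 + ‖φ‖) ^ k))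
  refine hprod.mono' ?_ (Filter.Eventually.of_forall fun z => ?_)
  · have hc : Continuous fun z : (Λ → ℂ) × (Λ → ℂ) =>
        f (φ + z.1 + z.2) * Boson.gaussWeight A₁ z.2 * Boson.gaussWeight A₂ z.1 := by
      unfold Boson.gaussWeight Boson.quadForm
      exact ((hf.comp (by fun_prop)).mul (by fun_prop)).mul (by fun_prop)
    exact hc.aestronglyMeasurable
  · rcases z with ⟨ξ₂, ξ₁⟩
    simp only [norm_mul, Complex.norm_real, Real.norm_eq_abs]
    rw [abs_of_nonneg (by positivity), abs_of_nonneg (by positivity)]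
    have hfx := hfb (φ + ξ₂ + ξ₁)
    have hnorm : ‖φ + ξ₂ + ξ₁‖ ≤ ‖φ‖ + ‖ξ₂‖ + ‖ξ₁‖ := by
      have e1 := norm_add_le (φ + ξ₂) ξ₁; have e2 := norm_add_le φ ξ₂; linarith
    have hpow : (1 + ‖φ + ξ₂ + ξ₁‖) ^ k ≤ ((1 + ‖φ‖) * (1 + ‖ξ₂‖) * (1 + ‖ξ₁‖)) ^ k := by
      refine pow_le_pow_left₀ (by positivity) ?_ k
      calc 1 + ‖φ + ξ₂ + ξ₁‖ ≤ 1 + ‖φ‖ + ‖ξ₂‖ + ‖ξ₁‖ := by linarith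
        _ ≤ (1 + ‖φ‖) * (1 + ‖ξ₂‖) * (1 + ‖ξ₁‖) := one_add_three_le (norm_nonneg _) (norm_nonneg _) (norm_nonneg _)
    have hg0 : 0 ≤ ‖Boson.gaussWeight A₁ ξ₁‖ * ‖Boson.gaussWeight A₂ ξ₂‖ := by positivity
    calc ‖f (φ + ξ₂ + ξ₁)‖ * ‖Boson.gaussWeight A₁ ξ₁‖ * ‖Boson.gaussWeight A₂ ξ₂‖
        ≤ K * ((1 + ‖φ‖) * (1 + ‖ξ₂‖) * (1 + ‖ξ₁‖)) ^ k * (‖Boson.gaussWeight A₁ ξ₁‖ * ‖Boson.gaussWeight A₂ ξ₂‖) := by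
          rw [mul_assoc]
          exact mul_le_mul_of_nonneg_right (hfx.trans (mul_le_mul_of_nonneg_left hpow hK)) hg0
      _ = K * (1 + ‖φ‖) ^ k * ((1 + ‖ξ₂‖) ^ k * ‖Boson.gaussWeight A₂ ξ₂‖ * ((1 + ‖ξ₁‖) ^ k * ‖Boson.gaussWeight A₁ ξ₁‖)) := by
          rw [mul_pow, mul_pow]; ring

/-- **`μ_{C₂} * (μ_{C₁} * f) = μ_{C₁+C₂} * f`**: Gaussian convolutions compose, the covariances add
(`(convMatrix A₁ A₂)⁻¹ = A₁⁻¹ + A₂⁻¹`), for real symmetric positive-definite `A₁, A₂` and continuous `f` of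
polynomial growth — the identity `E(f(X)) = E(E(f(X₁+X₂)|X₂))` of (5.1) for the complex Gaussian field on
`Λ`. [cite: BauerschmidtBrydgesSlade2015LogCorr, §5.1, eq. (5.1)] -/
theorem gaussConvolution_gaussConvolution (h₁ : RealPosDef A₁ c₁) (h₂ : RealPosDef A₂ c₂) {f : FieldFun Λ}
    (hf : Continuous f) {K : ℝ} {k : ℕ} (hfb : ∀ x, ‖f x‖ ≤ K * (1 + ‖x‖) ^ k) (φ : Λ → ℂ) :
    gaussConvolution A₂ (gaussConvolution A₁ f) φ = gaussConvolution (convMatrix A₁ A₂) f φ := by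
  have hB : RealPosDef (A₁ + A₂) (c₁ + c₂) := h₁.add h₂
  have hpi : (Real.pi : ℂ) ^ Fintype.card Λ ≠ 0 := pow_ne_zero _ (by exact_mod_cast Real.pi_ne_zero)
  have hdetB : (A₁ + A₂).det ≠ 0 := hB.isUnit_det.ne_zero
  -- the integrand on the product and its sheared version
  set F₀ : (Λ → ℂ) × (Λ → ℂ) → ℂ := fun z => f (φ + z.1 + z.2) * Boson.gaussWeight A₁ z.2 * Boson.gaussWeight A₂ z.1
    with hF₀
  set Kf : (Λ → ℂ) × (Λ → ℂ) → ℂ := fun z => f (φ + z.2) * (Boson.gaussWeight A₁ (z.2 - z.1) * Boson.gaussWeight A₂ z.1)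
    with hKf
  have hshear : MeasurePreserving (fun z : (Λ → ℂ) × (Λ → ℂ) => (z.1, z.1 + z.2))
      ((volume : Measure (Λ → ℂ)).prod volume) ((volume : Measure (Λ → ℂ)).prod volume) :=
    measurePreserving_prod_add volume volume
  have hemb : MeasurableEmbedding (fun z : (Λ → ℂ) × (Λ → ℂ) => (z.1, z.1 + z.2)) :=
    (MeasurableEquiv.shearAddRight (Λ → ℂ)).measurableEmbedding
  have hcomp : ∀ z : (Λ → ℂ) × (Λ → ℂ), F₀ z = Kf (z.1, z.1 + z.2) := by
    intro z; simp only [hF₀, hKf, add_sub_cancel_left, add_assoc]; ring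
  have hF₀int : Integrable F₀ ((volume : Measure (Λ → ℂ)).prod volume) :=
    integrable_shift_mul_gaussWeight_prod h₁ h₂ hf hfb φ
  have hKint : Integrable Kf ((volume : Measure (Λ → ℂ)).prod volume) := by
    rw [← hshear.integrable_comp_emb hemb (g := Kf)]
    exact hF₀int.congr (Filter.Eventually.of_forall hcomp)
  -- LHS as an integral over the product
  have hlhs : gaussConvolution A₂ (gaussConvolution A₁ f) φ =
      A₂.det / (Real.pi : ℂ) ^ Fintype.card Λ * (A₁.det / (Real.pi : ℂ) ^ Fintype.card Λ) *
        ∫ z, F₀ z ∂((volume : Measure (Λ → ℂ)).prod volume) := by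
    rw [integral_prod _ hF₀int]
    show A₂.det / (Real.pi : ℂ) ^ Fintype.card Λ * ∫ ξ₂ : Λ → ℂ, (A₁.det / (Real.pi : ℂ) ^ Fintype.card Λ *
        ∫ ξ₁ : Λ → ℂ, f (φ + ξ₂ + ξ₁) * Boson.gaussWeight A₁ ξ₁) * Boson.gaussWeight A₂ ξ₂ = _
    rw [mul_assoc (A₂.det / (Real.pi : ℂ) ^ Fintype.card Λ), ← integral_const_mul (A₁.det / (Real.pi : ℂ) ^ Fintype.card Λ)]
    congr 1
    refine integral_congr_ae (Filter.Eventually.of_forall fun ξ₂ => ?_)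
    show (A₁.det / (Real.pi : ℂ) ^ Fintype.card Λ * ∫ ξ₁ : Λ → ℂ, f (φ + ξ₂ + ξ₁) * Boson.gaussWeight A₁ ξ₁) *
        Boson.gaussWeight A₂ ξ₂ = A₁.det / (Real.pi : ℂ) ^ Fintype.card Λ * ∫ ξ₁ : Λ → ℂ, F₀ (ξ₂, ξ₁)
    rw [mul_assoc, ← integral_mul_const]
  -- shear, Fubini the other way, and the Gaussian integral in `ξ₂`
  have hmid : ∫ z, F₀ z ∂((volume : Measure (Λ → ℂ)).prod volume) =
      ∫ ξ : Λ → ℂ, f (φ + ξ) * (Boson.partitionFn (A₁ + A₂) * Boson.gaussWeight (convMatrix A₁ A₂) ξ) := by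
    calc ∫ z, F₀ z ∂((volume : Measure (Λ → ℂ)).prod volume)
        = ∫ z, Kf (z.1, z.1 + z.2) ∂((volume : Measure (Λ → ℂ)).prod volume) :=
          integral_congr_ae (Filter.Eventually.of_forall hcomp)
      _ = ∫ z, Kf z ∂((volume : Measure (Λ → ℂ)).prod volume) := hshear.integral_comp hemb Kf
      _ = ∫ ξ₂ : Λ → ℂ, ∫ ξ : Λ → ℂ, Kf (ξ₂, ξ) := integral_prod _ hKint
      _ = ∫ ξ : Λ → ℂ, ∫ ξ₂ : Λ → ℂ, Kf (ξ₂, ξ) := integral_integral_swap (by simpa [Function.uncurry_def] using hKint)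
      _ = ∫ ξ : Λ → ℂ, f (φ + ξ) * (Boson.partitionFn (A₁ + A₂) * Boson.gaussWeight (convMatrix A₁ A₂) ξ) := by
          refine integral_congr_ae (Filter.Eventually.of_forall fun ξ => ?_)
          simp only [hKf]
          rw [integral_const_mul, integral_gaussWeight_sub_mul_gaussWeight h₁ h₂ ξ]
  -- constants
  rw [hlhs, hmid, gaussConvolution]
  simp_rw [← mul_assoc (f (φ + _)) (Boson.partitionFn _), mul_comm (f (φ + _)) (Boson.partitionFn (A₁ + A₂)), mul_assoc]
  rw [integral_const_mul, ← mul_assoc, partitionFn_eq hB.pos hB.bound, convMatrix, Matrix.det_mul, Matrix.det_mul,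
    Matrix.det_nonsing_inv, Ring.inverse_eq_inv']
  field_simp

/-- **Proposition 5.1 on degree-zero forms (bosonic part): `E_{C₂}θ(E_{C₁}θ f) = E_{C₁+C₂}θ f`** with
`C_i = A_i⁻¹`, `C₁ + C₂ = (convMatrix A₁ A₂)⁻¹` — from `convTheta_ofFun` (eq. (4.22)) and the composition of
Gaussian convolutions. [cite: BauerschmidtBrydgesSlade2015LogCorr, §5.1, Proposition 5.1 (degree-zero F)] -/
theorem convTheta_ofFun_gaussConvolution (h₁ : RealPosDef A₁ c₁) (h₂ : RealPosDef A₂ c₂) {f : FieldFun Λ}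
    (hf : Continuous f) {K : ℝ} {k : ℕ} (hfb : ∀ x, ‖f x‖ ≤ K * (1 + ‖x‖) ^ k) :
    convTheta A₂ (convTheta A₁ (ofFun f)) = convTheta (convMatrix A₁ A₂) (ofFun f) := by
  rw [convTheta_ofFun, convTheta_ofFun, convTheta_ofFun]
  congr 1
  funext φ
  exact gaussConvolution_gaussConvolution h₁ h₂ hf hfb φ

end Convolution

end CTWSAW

end Literature.Barriers.CriticalPhenomena
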